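import Summits.Ventures.YMGap.RobustBall.RobustStarDoorZdW
import HarnessLib

/-!
# Venture YMGap, track ROBUST-BALL — ONE STATE AT A RATE THROUGH THE WEIGHTED (arbitrary-range) `ℤ^d` STAR DOOR: every finite volume of
# a member of the tier-2 diameter-weighted ball `MemBallZdW κ ε₀ ε₁` forgets its boundary field at the star rate

HONEST FRAMING. WHAT THIS IS: a venture file (cell `pub-ymgap`, track Y2 ROBUST-BALL, seat ds-3, theorems only), the weighted twin of
`StarBoundaryDecayZd.lean`. The Literature's weighted boundary-insensitivity theorem for window kernels of ARBITRARY range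
(`DobrushinShlosman.abs_integral_sub_integral_le_window_weighted`, Dobrushin–Shlosman 1985 Thm. 1 / Georgii 2011 Remark 8.26, by the
one-exterior-cell device) is fed with ds-2's weighted star door `StarWindowBoundZdW` and the DEPTH PROFILE of the volume:
* `exists_starDepthProfileW` — for a finite link volume `Λ₀` and a depth function `φ` (`1`-Lipschitz in the sup-norm of base points,
  `φ > 0 ⇒ ∈ Λ₀`): `ρ = φ − 1` is `≤ 0` off `Λ₀` and on the links of `Λ₀` lying in no star `⊆ Λ₀`, and `ρ x ≤ ρ y + reach(c.1, y)`;
* ★★ `abs_kernel_sub_kernel_le_of_starWindowBoundZdW` — DOOR LEVEL: under `StarWindowBoundZdW γ t ρ reach suFrobDist` (rate `t ≥ 0`, received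
  sum `ρ < 1`, reach dominating the sup-distance from the star), for every finite `Λ₀`, ANY TWO boundary fields `ω, η` and every bounded
  measurable `F` on links `Δ ⊆ Λ₀` with `φ ≥ m` on `Δ`: `|∫F dγ_{Λ₀}(·|ω) − ∫F dγ_{Λ₀}(·|η)| ≤ 2√N e^{t} e^{−t m} Σ_Δ δ`;
  `abs_kernel_sub_integral_le_of_starWindowBoundZdW` — against EVERY Gibbs measure (DLR);
* ★★ `boundary_decay_of_robustStarW` — THE TIER-2 DIAMETER-WEIGHTED BALL (hypotheses of ds-2's `massGapOnBallZdW_of_robustStar`): for EVERY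
  member `W ∈ MemBallZdW κ ε₀ ε₁`, every DLR state `μ` of the member, every finite `Λ₀`, EVERY boundary field `η`, every Lipschitz cylinder `F`
  (constant `K`, links `Δ ⊆ Λ₀` at depth `φ ≥ m`): `|∫F dγ^{W,S}_{Λ₀}(·|η) − ∫F dμ| ≤ 2√N e^{t} · K · #Δ · e^{−t m}`.
WHAT THIS IS NOT: no number (the `SU(2)` rows of the tier-2 star ball are ds-2's `MassGapOnBallZdWRows`); the rate `t` and the radii are door
artefacts; strong-coupling LATTICE statements; nothing about the continuum limit or the Clay Millennium problem.

References: R. L. Dobrushin, S. B. Shlosman (1985) Thm. 1; H. Föllmer, LNM 1362 (1988) Ch. I (2.8)–(2.10), Cor. (2.14); H.-O. Georgii (2011)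
Remark 8.26; the Literature's `DobrushinShlosmanWeightedInfiniteVolume.lean`; ds-2's `StarDoorZdW.lean`, `RobustStarDoorZdW.lean`; the seat's
`StarBoundaryDecayZd.lean`, `BoundaryDecaySummable.lean`.
-/

noncomputable section

open MeasureTheory ProbabilityTheory Function Finset Real
open scoped NNReal
open Literature.Probability.LatticeModels
open Literature.Probability.LatticeModels.DobrushinMetric (IsLipBound integrable_of_abs_le')
open Literature.MathematicalPhysics.QuantumLattice hiding torusNorm
open Literature.MathematicalPhysics.QuantumFieldTheory (suFrobDist suFrobDist_nonneg suFrobDist_le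
  suFrobDist_self suEntries dist_suEntries_le_suFrobDist IsLipschitzCylinder)
open Literature.MathematicalPhysics.QuantumFieldTheory.Balaban1983to89.StrongCouplingDobrushinWindow (OneLinkKRModulus)
open Summit.Ventures.YMGap.DSWindowZd
open Summit.Ventures.YMGap.StarResolventDim (gaugeR doorPoly)

namespace Summit.Ventures.YMGap.RobustBall

variable {d N : ℕ}

/-! ### The depth profile, real weighted form -/

/-- **THE DEPTH PROFILE FOR THE WEIGHTED STAR WINDOWS**: for a finite link volume `Λ₀`, a depth function `φ` (`φ x ≤ φ y + ‖x.1 − y.1‖_∞`,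
`φ x > 0 ⇒ x ∈ Λ₀`) and a reach dominating the sup-distance from the star, `ρ = φ − 1` is `≤ 0` off `Λ₀` and on the links of `Λ₀` lying in no
star `⊆ Λ₀` (centred in `Λ₀`), and `ρ x ≤ ρ y + reach(c.1, y)` along every star. [folklore] -/
theorem exists_starDepthProfileW (reach : Site d → ZdEdge d → ℝ)
    (hreach : ∀ (s : Site d), ∀ x ∈ vertexStarZd s, ∀ y : ZdEdge d, ‖x.1 - y.1‖ ≤ reach s y)
    (K : Site d → ZdEdge d → ZdEdge d → ℝ) (Λ₀ : Finset (ZdEdge d)) (φ : ZdEdge d → ℝ)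
    (hφ : ∀ x y : ZdEdge d, φ x ≤ φ y + ‖x.1 - y.1‖) (hφΛ : ∀ x, 0 < φ x → x ∈ Λ₀) :
    ∃ ρ : ZdEdge d → ℝ,
      (∀ y, y ∉ Λ₀ → ρ y ≤ 0) ∧
      (∀ x ∈ Λ₀, (∀ c ∈ Λ₀, starWinZd c ⊆ Λ₀ → x ∉ starWinZd c) → ρ x ≤ 0) ∧
      (∀ c ∈ Λ₀, starWinZd c ⊆ Λ₀ → ∀ x ∈ starWinZd c, ∀ y, K c.1 y x ≠ 0 → ρ x ≤ ρ y + reach c.1 y) ∧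
      (∀ x, ρ x = φ x - 1) := by
  classical
  refine ⟨fun x => φ x - 1, ?_, ?_, ?_, fun x => rfl⟩
  · intro y hy
    have h : φ y ≤ 0 := by
      by_contra h'
      exact hy (hφΛ y (not_le.mp h'))
    show φ y - 1 ≤ 0
    linarith
  · intro x hx hunc
    show φ x - 1 ≤ 0
    by_contra hdeep
    have hsub : starWinZd x ⊆ Λ₀ := fun z hz => hφΛ z (by
      have h1 := hφ x z
      have h2 : ‖x.1 - z.1‖ ≤ 1 := by
        rw [norm_sub_rev]; exact norm_sub_le_one_of_mem_vertexStarZd hz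
      linarith)
    exact hunc x hx hsub (self_mem_starWinZd x)
  · intro c _ _ x hx y _
    show φ x - 1 ≤ φ y - 1 + reach c.1 y
    have h4 : ‖x.1 - y.1‖ ≤ reach c.1 y := hreach c.1 x hx y
    have h5 := hφ x y
    linarith

/-! ### Door level: two boundary fields, and every Gibbs measure -/

/-- ★★ **A FINITE VOLUME FORGETS ITS BOUNDARY FIELD THROUGH THE WEIGHTED STAR DOOR (arbitrary range).** Under the weighted star window bound
`StarWindowBoundZdW γ t ρ reach suFrobDist` (rate `t ≥ 0`, received sum `ρ < 1`, reach dominating the sup-distance from the star) for a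
specification `γ` on the links of `ℤ^d` with `SU(N)` spins: for every finite link volume `Λ₀`, ANY TWO boundary fields `ω, η`, every depth function
`φ` of `Λ₀` and every bounded measurable `F` on links `Δ ⊆ Λ₀` (`φ ≥ m` on `Δ`) with Frobenius-Lipschitz vector `δ`:
`|∫F dγ_{Λ₀}(·|ω) − ∫F dγ_{Λ₀}(·|η)| ≤ 2√N · e^{t} e^{−t m} Σ_{x ∈ Δ} δ x` (Literature
`DobrushinShlosman.abs_integral_sub_integral_le_window_weighted`, profile `φ − 1`). [folklore] -/
theorem abs_kernel_sub_kernel_le_of_starWindowBoundZdW {γ : Specification (ZdEdge d) (SUN N)}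
    (hγ : IsSpecification γ) {t ρ : ℝ} (ht : 0 ≤ t) (hρ0 : 0 ≤ ρ) (hρ1 : ρ < 1)
    {reach : Site d → ZdEdge d → ℝ} (hreach0 : ∀ s y, 0 ≤ reach s y)
    (hreach : ∀ (s : Site d), ∀ x ∈ vertexStarZd s, ∀ y : ZdEdge d, ‖x.1 - y.1‖ ≤ reach s y)
    (h : StarWindowBoundZdW d N γ t ρ reach suFrobDist)
    (Λ₀ : Finset (ZdEdge d)) (ω η : LGConfig d (SUN N)) (φ : ZdEdge d → ℝ)
    (hφ : ∀ x y : ZdEdge d, φ x ≤ φ y + ‖x.1 - y.1‖) (hφΛ : ∀ x, 0 < φ x → x ∈ Λ₀)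
    {F : LGConfig d (SUN N) → ℝ} (hFm : Measurable F) {B : ℝ} (hB : ∀ σ, |F σ| ≤ B) {Δ : Finset (ZdEdge d)}
    (hFdep : DependsOn F (Δ : Set (ZdEdge d))) {δ : ZdEdge d → ℝ} (hδ : IsLipBound suFrobDist F δ)
    (hΔ : Δ ⊆ Λ₀) {m : ℝ} (hm : ∀ x ∈ Δ, m ≤ φ x) :
    |∫ σ, F σ ∂(γ Λ₀ ω) - ∫ σ, F σ ∂(γ Λ₀ η)| ≤
      2 * Real.sqrt N * Real.exp t * Real.exp (-(t * m)) * ∑ x ∈ Δ, δ x := by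
  classical
  obtain ⟨K, hK0, hKs, hcontract, hsum⟩ := h
  have hR₀ : (0 : ℝ) ≤ 2 * Real.sqrt N := by positivity
  obtain ⟨ρf, hout, hunc, hlip, hρf⟩ := exists_starDepthProfileW reach hreach K Λ₀ φ hφ hφΛ
  have hFdepΛ : DependsOn F (Λ₀ : Set (ZdEdge d)) :=
    hFdep.mono fun v hv => Finset.mem_coe.2 (hΔ (Finset.mem_coe.1 hv))
  have key := DobrushinShlosman.abs_integral_sub_integral_le_window_weighted hγ suFrobDist_nonneg suFrobDist_le hR₀
    suFrobDist_self (win := starWinZd) (K := fun c => K c.1) (fun c y x => hK0 _ _ _) hcontract ht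
    (d := fun c y _ => reach c.1 y) (fun c y _ => hreach0 _ _) (fun c x => hKs c.1 x) hρ0 hρ1
    (fun c x hx => hsum c.1 x hx) Λ₀ ω η ρf hout hunc hlip hFm hB hFdepΛ (hδ.restrict hFdep)
  have hδ0 : ∀ x, 0 ≤ δ x := hδ.nonneg
  have hs : ∑ x ∈ Λ₀, Real.exp (-(t * ρf x)) * (if x ∈ Δ then δ x else 0) =
      ∑ x ∈ Δ, Real.exp (-(t * ρf x)) * δ x := by
    have h1 : ∑ x ∈ Λ₀, Real.exp (-(t * ρf x)) * (if x ∈ Δ then δ x else 0) =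
        ∑ x ∈ Λ₀, (if x ∈ Δ then Real.exp (-(t * ρf x)) * δ x else 0) :=
      Finset.sum_congr rfl fun x _ => by split_ifs <;> simp
    rw [h1, Finset.sum_ite_mem, Finset.inter_eq_right.2 hΔ]
  rw [hs] at key
  refine key.trans ?_
  have hθ : ∑ x ∈ Δ, Real.exp (-(t * ρf x)) * δ x ≤ Real.exp t * Real.exp (-(t * m)) * ∑ x ∈ Δ, δ x := by
    rw [Finset.mul_sum]
    refine Finset.sum_le_sum fun x hx => mul_le_mul_of_nonneg_right ?_ (hδ0 x)
    rw [← Real.exp_add]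
    refine Real.exp_le_exp.2 ?_
    have h1 : m - 1 ≤ ρf x := by rw [hρf x]; linarith [hm x hx]
    nlinarith
  calc 2 * Real.sqrt N * ∑ x ∈ Δ, Real.exp (-(t * ρf x)) * δ x
      ≤ 2 * Real.sqrt N * (Real.exp t * Real.exp (-(t * m)) * ∑ x ∈ Δ, δ x) := mul_le_mul_of_nonneg_left hθ hR₀
    _ = 2 * Real.sqrt N * Real.exp t * Real.exp (-(t * m)) * ∑ x ∈ Δ, δ x := by ring

/-- **Against every Gibbs measure** (DLR): under the weighted star window bound, for every Gibbs measure `μ` of `γ`, every finite `Λ₀`, EVERY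
boundary field `η`: `|∫F dγ_{Λ₀}(·|η) − ∫F dμ| ≤ 2√N · e^{t} e^{−t m} Σ_{Δ} δ`. [folklore] -/
theorem abs_kernel_sub_integral_le_of_starWindowBoundZdW {γ : Specification (ZdEdge d) (SUN N)}
    (hγ : IsSpecification γ) {t ρ : ℝ} (ht : 0 ≤ t) (hρ0 : 0 ≤ ρ) (hρ1 : ρ < 1)
    {reach : Site d → ZdEdge d → ℝ} (hreach0 : ∀ s y, 0 ≤ reach s y)
    (hreach : ∀ (s : Site d), ∀ x ∈ vertexStarZd s, ∀ y : ZdEdge d, ‖x.1 - y.1‖ ≤ reach s y)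
    (h : StarWindowBoundZdW d N γ t ρ reach suFrobDist)
    {μ : Measure (LGConfig d (SUN N))} (hμ : IsGibbsMeasure γ μ)
    (Λ₀ : Finset (ZdEdge d)) (η : LGConfig d (SUN N)) (φ : ZdEdge d → ℝ)
    (hφ : ∀ x y : ZdEdge d, φ x ≤ φ y + ‖x.1 - y.1‖) (hφΛ : ∀ x, 0 < φ x → x ∈ Λ₀)
    {F : LGConfig d (SUN N) → ℝ} (hFm : Measurable F) {B : ℝ} (hB : ∀ σ, |F σ| ≤ B) {Δ : Finset (ZdEdge d)}
    (hFdep : DependsOn F (Δ : Set (ZdEdge d))) {δ : ZdEdge d → ℝ} (hδ : IsLipBound suFrobDist F δ)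
    (hΔ : Δ ⊆ Λ₀) {m : ℝ} (hm : ∀ x ∈ Δ, m ≤ φ x) :
    |(∫ σ, F σ ∂(γ Λ₀ η)) - ∫ σ, F σ ∂μ| ≤
      2 * Real.sqrt N * Real.exp t * Real.exp (-(t * m)) * ∑ x ∈ Δ, δ x := by
  haveI := hμ.isProbabilityMeasure
  set C : ℝ := 2 * Real.sqrt N * Real.exp t * Real.exp (-(t * m)) * ∑ x ∈ Δ, δ x with hC
  have hpt : ∀ ω, |(∫ σ, F σ ∂(γ Λ₀ η)) - ∫ σ, F σ ∂(γ Λ₀ ω)| ≤ C := fun ω =>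
    abs_kernel_sub_kernel_le_of_starWindowBoundZdW hγ ht hρ0 hρ1 hreach0 hreach h Λ₀ η ω φ hφ hφΛ hFm hB hFdep hδ hΔ hm
  have hgm : Measurable fun ω => ∫ σ, F σ ∂(γ Λ₀ ω) := DobrushinShlosman.measurable_windowAvg' hγ Λ₀ hFm
  have hgB : ∀ ω, |∫ σ, F σ ∂(γ Λ₀ ω)| ≤ B := fun ω => DobrushinShlosman.abs_windowAvg_le' hγ Λ₀ hB ω
  have hgi : Integrable (fun ω => ∫ σ, F σ ∂(γ Λ₀ ω)) μ := integrable_of_abs_le' hgm hgB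
  have hDLR : ∫ σ, F σ ∂μ = ∫ ω, ∫ σ, F σ ∂(γ Λ₀ ω) ∂μ :=
    (hμ.integral_integral_eq hγ Λ₀ (integrable_of_abs_le' hFm hB)).symm
  rw [hDLR]
  have h1 : (∫ σ, F σ ∂(γ Λ₀ η)) - ∫ ω, ∫ σ, F σ ∂(γ Λ₀ ω) ∂μ =
      ∫ ω, ((∫ σ, F σ ∂(γ Λ₀ η)) - ∫ σ, F σ ∂(γ Λ₀ ω)) ∂μ := by
    rw [integral_sub (integrable_const _) hgi, integral_const, smul_eq_mul, probReal_univ, one_mul]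
  rw [h1]
  calc |∫ ω, ((∫ σ, F σ ∂(γ Λ₀ η)) - ∫ σ, F σ ∂(γ Λ₀ ω)) ∂μ|
      ≤ ∫ ω, |(∫ σ, F σ ∂(γ Λ₀ η)) - ∫ σ, F σ ∂(γ Λ₀ ω)| ∂μ := abs_integral_le_integral_abs
    _ ≤ ∫ _ω, C ∂μ := integral_mono_of_nonneg (ae_of_all _ fun ω => abs_nonneg _) (integrable_const C)
        (ae_of_all _ hpt)
    _ = C := by simp

/-! ### The tier-2 diameter-weighted ball through ds-2's robust star door -/

/-- ★★ **BOUNDARY DECAY UNIFORMLY ON THE TIER-2 DIAMETER-WEIGHTED `ℤ^d` BALL through the ROBUST STAR DOOR** (hypotheses of ds-2's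
`massGapOnBallZdW_of_robustStar` verbatim: near data of the tier-1 robust star door for the tree coupling `N β'`, weight `κ > 0`, rate `0 < t ≤ κ`,
far bound `τb`, closing inequality `≤ ρ' < 1`). For EVERY member `W ∈ MemBallZdW κ ε₀ ε₁`, every DLR state `μ` of the member, every finite link
volume `Λ₀`, EVERY boundary field `η`, every depth function `φ` of `Λ₀` and every Lipschitz cylinder `F` (constant `K₀`, links `Δ ⊆ Λ₀` with
`φ ≥ m` on `Δ`): `|∫F dγ^{W,S}_{Λ₀}(·|η) − ∫F dμ| ≤ 2√N e^{t} · K₀ · #Δ · e^{−t m}`. [folklore] -/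
theorem boundary_decay_of_robustStarW (hd : 2 ≤ d) (hN : 1 ≤ N)
    {β' κ ε₀ ε₁ Rm K c lam θ ρn t τb ρ' : ℝ} {D Kn : ℕ} (hD : 1 ≤ D)
    (hK : 0 ≤ K) (hRm : |(N : ℝ) * β'| / N * (2 * ((d : ℝ) - 1)) ≤ Rm) (hmod : OneLinkKRModulus N Rm K)
    (hε₁ : 0 ≤ ε₁)
    (hc : K * Real.exp ε₀ * (1 + 2 * Real.sqrt N * ε₁) * (|(N : ℝ) * β'| / N) ≤ c) (hlam : Real.sqrt N * ε₁ ≤ lam)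
    (hθ : θ = (2 * (d : ℝ) - 2) * c + lam) (hθ1 : θ < 1) (hcd : doorPoly d c < 1)
    (hρn : ρn = gaugeR d c + (lam + θ ^ Kn * (4 * d * lam)) / (1 - θ))
    (hκ : 0 < κ) (ht : 0 < t) (htκ : t ≤ κ)
    (hτb : (2 * Real.sqrt N) * (((d : ℝ) + 1) * Real.exp (-(κ * D)) * ε₁) ≤ τb)
    (hclose : Real.exp τb ^ 2 * Real.exp (t * ((max (2 * D) 1 + 2 : ℕ) + 1)) * ρn +
        (2 * Real.sqrt N) * (Real.exp τb ^ 2 + Real.exp τb ^ 4) * (((d : ℝ) + 1) * Real.exp (-(κ * D)) * ε₁) *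
          (Real.exp (t * ((max (2 * D) 1 + 2 : ℕ) + 1)) * ρn) +
        2 * (2 * Real.sqrt N) * (Real.exp τb ^ 2 + Real.exp τb ^ 4) *
          (((d : ℝ) + 1) * Real.exp (2 * t) * Real.exp (-((κ - t) * D)) * ε₁) ≤ ρ')
    (hρ'0 : 0 ≤ ρ') (hρ'1 : ρ' < 1)
    {W : Potential (ZdEdge d) (SUN N)} (hW : MemBallZdW κ ε₀ ε₁ W)
    {μ : Measure (LGConfig d (SUN N))}
    (hμ : μ ∈ perturbedGibbsMeasuresS (d := d) (fundamentalRep (Fin N)) ((N : ℝ) * β') W)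
    (Λ₀ : Finset (ZdEdge d)) (η : LGConfig d (SUN N)) (φ : ZdEdge d → ℝ)
    (hφ : ∀ x y : ZdEdge d, φ x ≤ φ y + ‖x.1 - y.1‖) (hφΛ : ∀ x, 0 < φ x → x ∈ Λ₀)
    {F : LGConfig d (SUN N) → ℝ} {Δ : Finset (ZdEdge d)} {K₀ : ℝ≥0}
    (hF : IsLipschitzCylinder (fundamentalRep (Fin N)) F Δ K₀) (hΔ : Δ ⊆ Λ₀) {m : ℝ} (hm : ∀ x ∈ Δ, m ≤ φ x) :
    |(∫ U, F U ∂(perturbedYMS (d := d) (fundamentalRep (Fin N)) ((N : ℝ) * β') W Λ₀ η)) - ∫ U, F U ∂μ| ≤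
      2 * Real.sqrt N * Real.exp t * K₀ * Δ.card * Real.exp (-(t * m)) := by
  classical
  haveI : SecondCountableTopology (Matrix (Fin N) (Fin N) ℂ) :=
    inferInstanceAs (SecondCountableTopology (Fin N → Fin N → ℂ))
  haveI : SecondCountableTopology (SUN N) := Topology.IsEmbedding.subtypeVal.secondCountableTopology
  obtain ⟨Bm, hBm⟩ := hW.summable
  have hγ : IsSpecification (perturbedYMS (d := d) (fundamentalRep (Fin N)) ((N : ℝ) * β') W) :=
    isSpecification_perturbedYMS _ (continuous_fundamentalRep (Fin N)) _ hBm hW.continuous hW.dependsOn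
  have hD'eq : 2 * D + 2 ≤ max (2 * D) 1 + 2 := by omega
  have hnear : ∀ s : Site d, StarWindowBoundZdR d N
      (perturbedYM (d := d) (fundamentalRep (Fin N)) ((N : ℝ) * β') (truncZd D s W) (truncSuppZd D s))
      (max (2 * D) 1 + 2) ρn suFrobDist := fun s =>
    starWindowBoundZdR_of_memBallZdG hd hN hK hRm hmod hε₁ hc hlam hθ hθ1 hcd hρn (hW.truncZd_mem hκ.le D s)
  have h := starWindowBoundZdW_of_near (N := N) hD'eq hκ ht.le htκ hτb (by exact_mod_cast hclose) hW hnear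
  have hreach0 : ∀ (s : Site d) (y : ZdEdge d), 0 ≤ ‖y.1 - s‖ + 1 := fun s y => by positivity
  have hreach : ∀ (s : Site d), ∀ x ∈ vertexStarZd s, ∀ y : ZdEdge d, ‖x.1 - y.1‖ ≤ ‖y.1 - s‖ + 1 :=
    fun s x hx y => by
      calc ‖x.1 - y.1‖ = ‖(x.1 - s) - (y.1 - s)‖ := by congr 1; abel
        _ ≤ ‖x.1 - s‖ + ‖y.1 - s‖ := norm_sub_le _ _
        _ ≤ 1 + ‖y.1 - s‖ := by linarith [norm_sub_le_one_of_mem_vertexStarZd hx]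
        _ = ‖y.1 - s‖ + 1 := by ring
  have hA : ∀ a b : SUN N, dist (suEntries a) (suEntries b) ≤ 1 * suFrobDist a b := fun a b => by
    rw [one_mul]; exact dist_suEntries_le_suFrobDist a b
  have hμ' : IsGibbsMeasure (perturbedYMS (d := d) (fundamentalRep (Fin N)) ((N : ℝ) * β') W) μ := hμ
  have key := abs_kernel_sub_integral_le_of_starWindowBoundZdW hγ ht.le hρ'0 hρ'1 hreach0 hreach h hμ' Λ₀ η φ hφ hφΛ
    hF.measurable hF.abs_le hF.dependsOn (hF.isLipBound zero_le_one hA) hΔ hm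
  have hsum₁ : ∑ y ∈ Δ, (if y ∈ Δ then 1 * (K₀ : ℝ) else 0) = Δ.card * K₀ := by
    rw [Finset.sum_ite_of_true (fun y hy => hy), Finset.sum_const, nsmul_eq_mul, one_mul]
  rw [hsum₁] at key
  refine key.trans (le_of_eq ?_)
  ring

end Summit.Ventures.YMGap.RobustBall

end
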